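import Summits.SmoothPoincare4.SmoothPoincare4.Theorems.CongruenceShadowsShadowApproximationStubGoeritzThreeRealisersTwo
import Summits.SmoothPoincare4.SmoothPoincare4.Theorems.CongruenceShadowsShadowApproximationStubGoeritzThreeReduction
import Literature.Topology.FourManifolds.SurfaceGroupSymplecticRealisation
import Literature.Algebra.Lie.SurfaceLieAlgebra
import HarnessLib

/-!
# Stub `stub_goeritzRealisationThree` of line `nilpotent-genus-class` for crux
`CongruenceShadows.ShadowApproximation` (item stmt-SmoothPoincare4-14595, route CongruenceShadows) —
the Goeritz group of the genus-3 splitting realises the whole integral pair-stabiliser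

Setting: `S₃ = SurfaceGroup 3`, `H₁ = (surfaceGen 3 → ℤ)` with the intersection form `ν = symplForm` and
the Hurewicz map `SurfaceGroup.abelianize 3`; the standard Heegaard pair `N₀ = s4Kernels 0 = ⟪a₀,a₁,b₂⟫`,
`N₁ = s4Kernels 1 = ⟪a₀,b₁,a₂⟫` of the genus-`3` trisection of `S⁴` (the genus-`3` splitting of
`S¹×S²`), with coordinate Lagrangians `Λᵢ = span{δ_y : y ∈ s4Gens i}` (`= s4CutSystem 0 i`).

**`stub_goeritzRealisationThree`** (registered, proved verbatim at genus `3 + 3·0`): every `ℤ`-linear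
automorphism `F` of `H₁` with `ν(Fu, Fv) = ε ν(u, v)` (`ε = ±1`), `F(Λ₀) = Λ₀`, `F(Λ₁) = Λ₁` is induced
by an automorphism `x` of `S₃` with `x(N₀) = N₀`, `x(N₁) = N₁` — the Goeritz group
`Stab N₀ ∩ Stab N₁` maps ONTO the integral pair-stabiliser `Stab_{Sp^±(6,ℤ)}(Λ₀, Λ₁)`.

Proof.  Let `R ≤ GL(H₁)` be the subgroup of linear automorphisms induced by Goeritz elements
(`exists_goeritzRealisable`; closed under products and inverses because realisers compose).  By the
helper files `…StubGoeritzThreeRealisers(Two).lean`, `R` contains `moveX 0 c`, `moveW 0 1 c`,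
`moveW 0 2 c`, `moveW 1 2 c`, `moveE c`, `moveZ 0 1 c`, `moveZ 0 2 c` (explicit slides / twists, the
parameter `c` by `shear_mem`), the handle signs `negHandle k` and the reflection's action `negB`.  If
`ε = -1` replace `F` by `negB · F` (`stabiliser_of_neg`).  By `…StubGoeritzThreeReduction.lean`
(steps 1–4: sign of `F a₀`, Euclid on the Levi block, second column, killing `α, β`) some `r ∈ R`
makes `r F` fix `a₀, a₁, b₂`; by RIGIDITY (`eq_moves_of_fix`, proved here: the form pins all remaining
coordinates) `r F = moveX 0 c₀ · moveW 0 1 γ · moveZ 0 2 δ ∈ R`; hence `F ∈ R` (`mem_of_stabiliser`).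
The coordinate description of the spans (`mem_span_single_image_iff`) translates the hypotheses.
Classical background: Zieschang–Vogt–Coldewey §3.6 (elementary symplectic moves are induced by
surface-group automorphisms); no 4-dimensional input. [folklore]

## References

* H. Zieschang, E. Vogt, H.-D. Coldewey, *Surfaces and Planar Discontinuous Groups*, LNM 835,
  Springer (1980), §3.6. [ZieschangVogtColdewey1980]
-/

-- the prescribed namespace `Summit.<P>.<Sub>.…` duplicates `SmoothPoincare4` (P = Sub)
set_option linter.dupNamespace false
noncomputable section
open Literature.Topology.FourManifolds Literature.Algebra.Lie Multiplicative

namespace Summit.SmoothPoincare4.SmoothPoincare4.Theorems.ShadowApproximation.NilpotentGenusClass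

/-! ## Notation (file-local, as in the reduction helper) -/

local notation "H₁" => surfaceGen 3 → ℤ
local notation "𝔞₀" => (((0 : Fin 3), false) : surfaceGen 3)
local notation "𝔟₀" => (((0 : Fin 3), true) : surfaceGen 3)
local notation "𝔞₁" => (((1 : Fin 3), false) : surfaceGen 3)
local notation "𝔟₁" => (((1 : Fin 3), true) : surfaceGen 3)
local notation "𝔞₂" => (((2 : Fin 3), false) : surfaceGen 3)
local notation "𝔟₂" => (((2 : Fin 3), true) : surfaceGen 3)
local notation "δ[" x "]" => (Pi.single x (1 : ℤ) : surfaceGen 3 → ℤ)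

/-- `InL0⟪v⟫`: `v ∈ Λ₀ = ⟨a₀,a₁,b₂⟩`, in coordinates. -/
local notation3 "InL0⟪" v "⟫" => (v : H₁) 𝔟₀ = 0 ∧ (v : H₁) 𝔟₁ = 0 ∧ (v : H₁) 𝔞₂ = 0
/-- `InL1⟪v⟫`: `v ∈ Λ₁ = ⟨a₀,b₁,a₂⟩`, in coordinates. -/
local notation3 "InL1⟪" v "⟫" => (v : H₁) 𝔟₀ = 0 ∧ (v : H₁) 𝔞₁ = 0 ∧ (v : H₁) 𝔟₂ = 0
/-- `InP⟪F⟫`: `F` is an isometry of `ν` mapping `Λ₀` into `Λ₀` and `Λ₁` into `Λ₁`. -/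
local notation3 "InP⟪" F "⟫" =>
  (∀ u v : H₁, symplForm ((F : H₁ ≃ₗ[ℤ] H₁) u) ((F : H₁ ≃ₗ[ℤ] H₁) v) = symplForm u v) ∧
    (∀ v : H₁, InL0⟪v⟫ → InL0⟪(F : H₁ ≃ₗ[ℤ] H₁) v⟫) ∧
    (∀ v : H₁, InL1⟪v⟫ → InL1⟪(F : H₁ ≃ₗ[ℤ] H₁) v⟫)
/-- `InQ⟪F⟫`: `InP⟪F⟫` and `F a₀ = a₀`. -/
local notation3 "InQ⟪" F "⟫" => InP⟪F⟫ ∧ (F : H₁ ≃ₗ[ℤ] H₁) δ[𝔞₀] = δ[𝔞₀]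
/-- `Goeritz⟪σ, f⟫`: `σ` stabilises `N₀` and `N₁` and induces `f` on `H₁`. -/
local notation3 "Goeritz⟪" σ ", " f "⟫" =>
  Subgroup.map (MulEquiv.toMonoidHom (σ : SurfaceGroup 3 ≃* SurfaceGroup 3)) (s4Kernels 0) =
      s4Kernels 0 ∧
    Subgroup.map (MulEquiv.toMonoidHom (σ : SurfaceGroup 3 ≃* SurfaceGroup 3)) (s4Kernels 1) =
      s4Kernels 1 ∧
    ∀ s : SurfaceGroup 3, toAdd (SurfaceGroup.abelianize 3 ((σ : SurfaceGroup 3 ≃* SurfaceGroup 3) s)) =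
      (f : (surfaceGen 3 → ℤ) ≃ₗ[ℤ] (surfaceGen 3 → ℤ)) (toAdd (SurfaceGroup.abelianize 3 s))

/-! ## Step 5: rigidity -/

/-- **Rigidity.** An isometry in the stabiliser fixing `a₀, a₁, b₂` is the product
`moveX 0 c₀ · moveW 0 1 γ · moveZ 0 2 δ` with `c₀ = (F b₀)(a₀)`, `γ = (F b₁)(a₀)`, `δ = (F a₂)(a₀)`:
the form pins down every other coordinate of `F b₀, F b₁, F a₂`. [folklore] -/
theorem eq_moves_of_fix {F : H₁ ≃ₗ[ℤ] H₁} (hF : InP⟪F⟫) (h0 : F δ[𝔞₀] = δ[𝔞₀]) (h1 : F δ[𝔞₁] = δ[𝔞₁])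
    (h2 : F δ[𝔟₂] = δ[𝔟₂]) :
    F = moveX 0 (F δ[𝔟₀] 𝔞₀) * moveW 0 1 (F δ[𝔟₁] 𝔞₀) * moveZ 0 2 (by decide) (F δ[𝔞₂] 𝔞₀) := by
  have h02 : (0 : Fin 3) ≠ 2 := by decide
  have h01 : (0 : Fin 3) ≠ 1 := by decide
  -- coordinates of `F b₁`
  obtain ⟨e_b0, e_a1, e_b2⟩ := hF.2.2 δ[𝔟₁] ⟨by simp, by simp, by simp⟩
  have e_b1 : F δ[𝔟₁] 𝔟₁ = 1 := by
    have hν : symplForm (F δ[𝔞₁]) (F δ[𝔟₁]) = 1 := by rw [hF.1]; simp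
    rwa [h1, symplForm_single_false_left, one_mul] at hν
  have e_a2 : F δ[𝔟₁] 𝔞₂ = 0 := by
    have hν : symplForm (F δ[𝔟₂]) (F δ[𝔟₁]) = 0 := by rw [hF.1]; simp
    rw [h2, symplForm_single_true_left, one_mul, neg_eq_zero] at hν
    exact hν
  -- coordinates of `F a₂`
  obtain ⟨d_b0, d_a1, d_b2⟩ := hF.2.2 δ[𝔞₂] ⟨by simp, by simp, by simp⟩
  have d_b1 : F δ[𝔞₂] 𝔟₁ = 0 := by
    have hν : symplForm (F δ[𝔞₁]) (F δ[𝔞₂]) = 0 := by rw [hF.1]; simp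
    rwa [h1, symplForm_single_false_left, one_mul] at hν
  have d_a2 : F δ[𝔞₂] 𝔞₂ = 1 := by
    have hν : symplForm (F δ[𝔟₂]) (F δ[𝔞₂]) = -1 := by rw [hF.1]; simp
    rw [h2, symplForm_single_true_left, one_mul] at hν
    linear_combination -hν
  -- coordinates of `F b₀`
  have f_b0 : F δ[𝔟₀] 𝔟₀ = 1 := by
    have hν : symplForm (F δ[𝔞₀]) (F δ[𝔟₀]) = 1 := by rw [hF.1]; simp
    rwa [h0, symplForm_single_false_left, one_mul] at hν
  have f_b1 : F δ[𝔟₀] 𝔟₁ = 0 := by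
    have hν : symplForm (F δ[𝔞₁]) (F δ[𝔟₀]) = 0 := by rw [hF.1]; simp
    rwa [h1, symplForm_single_false_left, one_mul] at hν
  have f_a2 : F δ[𝔟₀] 𝔞₂ = 0 := by
    have hν : symplForm (F δ[𝔟₂]) (F δ[𝔟₀]) = 0 := by rw [hF.1]; simp
    rw [h2, symplForm_single_true_left, one_mul, neg_eq_zero] at hν
    exact hν
  have f_a1 : F δ[𝔟₀] 𝔞₁ = F δ[𝔟₁] 𝔞₀ := by
    have hν : symplForm (F δ[𝔟₁]) (F δ[𝔟₀]) = 0 := by rw [hF.1]; simp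
    rw [symplForm_three, e_b0, e_a1, e_b2, e_b1, e_a2, f_b0] at hν
    linear_combination -hν
  have f_b2 : F δ[𝔟₀] 𝔟₂ = -F δ[𝔞₂] 𝔞₀ := by
    have hν : symplForm (F δ[𝔞₂]) (F δ[𝔟₀]) = 0 := by rw [hF.1]; simp
    rw [symplForm_three, d_b0, d_a1, d_b2, d_b1, d_a2, f_b0] at hν
    linear_combination hν
  -- compare on the basis
  refine linearEquiv_ext fun x => ?_
  simp only [linearEquiv_mul_apply]
  obtain ⟨i, b⟩ := x
  fin_cases i <;> cases b <;> simp only [Fin.zero_eta, Fin.mk_one, Fin.reduceFinMk, Fin.isValue]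
  · -- `a₀`
    rw [h0, moveZ_single_of_ne h02 _ (by simp) (by simp), moveW_single_of_ne 0 1 _ (by simp) (by simp),
      moveX_single_of_ne 0 _ (by simp)]
  · -- `b₀`
    rw [moveZ_single_true h02, map_sub, map_zsmul, map_sub, map_zsmul,
      moveW_single_true_left h01, moveW_single_of_ne 0 1 _ (by simp) (by simp), map_add, map_zsmul,
      moveX_single_true, moveX_single_of_ne 0 _ (by simp), moveX_single_of_ne 0 _ (by simp)]
    refine vec_ext ?_ ?_ ?_ ?_ ?_ ?_ <;> simp [f_b0, f_b1, f_a2, f_a1, f_b2]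
  · -- `a₁`
    rw [h1, moveZ_single_of_ne h02 _ (by simp) (by simp), moveW_single_of_ne 0 1 _ (by simp) (by simp),
      moveX_single_of_ne 0 _ (by simp)]
  · -- `b₁`
    rw [moveZ_single_of_ne h02 _ (by simp) (by simp), moveW_single_true_right h01, map_add, map_zsmul,
      moveX_single_of_ne 0 _ (by simp), moveX_single_of_ne 0 _ (by simp)]
    refine vec_ext ?_ ?_ ?_ ?_ ?_ ?_ <;> simp [e_b0, e_a1, e_b2, e_b1, e_a2]
  · -- `a₂`
    rw [moveZ_single_false h02, map_add, map_zsmul, moveW_single_of_ne 0 1 _ (by simp) (by simp),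
      moveW_single_of_ne 0 1 _ (by simp) (by simp), map_add, map_zsmul,
      moveX_single_of_ne 0 _ (by simp), moveX_single_of_ne 0 _ (by simp)]
    refine vec_ext ?_ ?_ ?_ ?_ ?_ ?_ <;> simp [d_b0, d_a1, d_b2, d_b1, d_a2]
  · -- `b₂`
    rw [h2, moveZ_single_of_ne h02 _ (by simp) (by simp), moveW_single_of_ne 0 1 _ (by simp) (by simp),
      moveX_single_of_ne 0 _ (by simp)]

/-! ## Assembly of the reduction -/

/-- **The reduction.** Every isometry of `ν` mapping `Λ₀` into `Λ₀` and `Λ₁` into `Λ₁` lies in any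
subgroup of `GL(H₁)` containing the moves `moveX 0 c`, `moveW 0 1 c`, `moveW 0 2 c`, `moveW 1 2 c`,
`moveZ 0 1 c`, `moveZ 0 2 c`, lower unipotents `E c` (`a₁ ↦ a₁ + c b₂`, `a₂ ↦ a₂ + c b₁`) and handle
signs `N k` (given through their coordinate formulas `hE`, `hN`). [folklore] -/
theorem mem_of_stabiliser (E : ℤ → (H₁ ≃ₗ[ℤ] H₁)) (N : Fin 3 → (H₁ ≃ₗ[ℤ] H₁))
    (hE : ∀ (c : ℤ) (v : H₁), E c v = v + c • (Pi.single 𝔟₂ (v 𝔞₁) + Pi.single 𝔟₁ (v 𝔞₂)))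
    (hN : ∀ (k : Fin 3) (v : H₁) (x : surfaceGen 3), N k v x = if x.1 = k then -v x else v x)
    (R : Subgroup (H₁ ≃ₗ[ℤ] H₁)) (hX : ∀ c, moveX 0 c ∈ R)
    (hW01 : ∀ c, moveW 0 1 c ∈ R) (hW02 : ∀ c, moveW 0 2 c ∈ R) (hW12 : ∀ c, moveW 1 2 c ∈ R)
    (hER : ∀ c, E c ∈ R) (hZ01 : ∀ c, moveZ 0 1 (by decide) c ∈ R)
    (hZ02 : ∀ c, moveZ 0 2 (by decide) c ∈ R) (hNR : ∀ k, N k ∈ R) (F : H₁ ≃ₗ[ℤ] H₁)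
    (hF : InP⟪F⟫) : F ∈ R := by
  -- step 1
  obtain ⟨r₀, hr₀, hQ₀⟩ : ∃ r₀ ∈ R, InQ⟪r₀ * F⟫ := by
    rcases apply_a0_eq hF with h | h
    · exact ⟨1, R.one_mem, by rw [one_mul]; exact ⟨hF, h⟩⟩
    · refine ⟨N 0, hNR 0, inP_mul (inP_N N hN 0) hF, ?_⟩
      rw [linearEquiv_mul_apply, h, map_neg, N_zero_single N hN, neg_neg]
  -- steps 2–4
  obtain ⟨r₁, hr₁, hr₁Q, h1, h2⟩ := euclid E N hE hN R hW12 hER hNR _ (r₀ * F) le_rfl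
    (isCoprime_of_inP hQ₀.1)
  have hQ₁ : InQ⟪r₁ * (r₀ * F)⟫ := inQ_mul hr₁Q hQ₀
  obtain ⟨r₂, hr₂, hr₂Q, h1', h2', h3', h4'⟩ := col_two N hN R hW12 hNR hQ₁ h1 h2
  have hQ₂ : InQ⟪r₂ * (r₁ * (r₀ * F))⟫ := inQ_mul hr₂Q hQ₁
  obtain ⟨r₃, hr₃, hr₃Q, e1, e2⟩ := fix_three R hZ01 hW02 hQ₂ h1' h2' h3' h4'
  have hQ₃ : InQ⟪r₃ * (r₂ * (r₁ * (r₀ * F)))⟫ := inQ_mul hr₃Q hQ₂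
  -- step 5
  have key := eq_moves_of_fix hQ₃.1 hQ₃.2 e1 e2
  have hmem : r₃ * (r₂ * (r₁ * (r₀ * F))) ∈ R := by
    rw [key]
    exact R.mul_mem (R.mul_mem (hX _) (hW01 _)) (hZ02 _)
  exact mem_of_mul_mem hr₀ (mem_of_mul_mem hr₁ (mem_of_mul_mem hr₂ (mem_of_mul_mem hr₃ hmem)))

/-! ## The orientation-reversing case and the spans -/

/-- A sign-reversing element `B` (`ν(Bu, Bv) = -ν(u,v)`, e.g. `bᵢ ↦ -bᵢ`) preserving `Λ₀, Λ₁` turns an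
anti-isometry of the stabiliser into an isometry of the stabiliser. [folklore] -/
theorem stabiliser_of_neg {B F : H₁ ≃ₗ[ℤ] H₁} (hB : ∀ u v, symplForm (B u) (B v) = -symplForm u v)
    (hB0 : ∀ v : H₁, InL0⟪v⟫ → InL0⟪B v⟫) (hB1 : ∀ v : H₁, InL1⟪v⟫ → InL1⟪B v⟫)
    (hF : ∀ u v, symplForm (F u) (F v) = -symplForm u v)
    (hF0 : ∀ v : H₁, InL0⟪v⟫ → InL0⟪F v⟫) (hF1 : ∀ v : H₁, InL1⟪v⟫ → InL1⟪F v⟫) : InP⟪B * F⟫ := by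
  refine ⟨fun u v => ?_, fun v hv => ?_, fun v hv => ?_⟩
  · rw [linearEquiv_mul_apply, linearEquiv_mul_apply, hB, hF, neg_neg]
  · rw [linearEquiv_mul_apply]; exact hB0 _ (hF0 v hv)
  · rw [linearEquiv_mul_apply]; exact hB1 _ (hF1 v hv)

/-- **The coordinate Lagrangian of a set of letters**: `v` lies in the span of the `δ_y`, `y ∈ C`,
iff its coordinates off `C` vanish. [folklore] -/
theorem mem_span_single_image_iff (C : Finset (surfaceGen 3)) (v : H₁) :
    v ∈ Submodule.span ℤ ((fun y => δ[y]) '' (C : Set (surfaceGen 3))) ↔ ∀ x ∉ C, v x = 0 := by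
  constructor
  · intro hv
    induction hv using Submodule.span_induction with
    | mem w hw =>
      obtain ⟨y, hy, rfl⟩ := hw
      intro x hx
      exact Pi.single_eq_of_ne (fun e => hx (by rw [e]; exact hy)) _
    | zero => intro x _; rfl
    | add u w _ _ hu hw => intro x hx; rw [Pi.add_apply, hu x hx, hw x hx, add_zero]
    | smul c w _ hw => intro x hx; rw [Pi.smul_apply, hw x hx, smul_zero]
  · intro hv
    rw [← Finset.univ_sum_single v]
    refine Submodule.sum_mem _ fun x _ => ?_
    by_cases hx : x ∈ C
    · have e : (Pi.single x (v x) : H₁) = v x • δ[x] := by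
        rw [← Pi.single_smul, smul_eq_mul, mul_one]
      rw [e]
      exact Submodule.smul_mem _ _ (Submodule.subset_span ⟨x, hx, rfl⟩)
    · rw [hv x hx, Pi.single_zero]
      exact Submodule.zero_mem _

/-- The span of the cut system `s4Gens 0 = {a₀,a₁,b₂}` is `Λ₀` in coordinates. [folklore] -/
theorem mem_span_s4Gens_zero_iff (v : H₁) :
    v ∈ Submodule.span ℤ ((fun y => δ[y]) '' (s4Gens 0 : Set (surfaceGen 3))) ↔ InL0⟪v⟫ := by
  rw [mem_span_single_image_iff]
  constructor
  · intro h
    exact ⟨h _ (by decide), h _ (by decide), h _ (by decide)⟩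
  · rintro ⟨h1, h2, h3⟩ ⟨i, b⟩ hx
    fin_cases i <;> cases b <;> first | exact absurd (by decide) hx | assumption

/-- The span of the cut system `s4Gens 1 = {a₀,b₁,a₂}` is `Λ₁` in coordinates. [folklore] -/
theorem mem_span_s4Gens_one_iff (v : H₁) :
    v ∈ Submodule.span ℤ ((fun y => δ[y]) '' (s4Gens 1 : Set (surfaceGen 3))) ↔ InL1⟪v⟫ := by
  rw [mem_span_single_image_iff]
  constructor
  · intro h
    exact ⟨h _ (by decide), h _ (by decide), h _ (by decide)⟩
  · rintro ⟨h1, h2, h3⟩ ⟨i, b⟩ hx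
    fin_cases i <;> cases b <;> first | exact absurd (by decide) hx | assumption


/-! ## The realisable subgroup -/

/-- Goeritz realisers compose. [folklore] -/
theorem goeritz_trans {σ τ : SurfaceGroup 3 ≃* SurfaceGroup 3} {f g : H₁ ≃ₗ[ℤ] H₁}
    (hσ : Goeritz⟪σ, f⟫) (hτ : Goeritz⟪τ, g⟫) : Goeritz⟪τ.trans σ, f * g⟫ := by
  have e : (τ.trans σ).toMonoidHom = σ.toMonoidHom.comp τ.toMonoidHom := rfl
  refine ⟨?_, ?_, realises_mul hσ.2.2 hτ.2.2⟩
  · rw [e, ← Subgroup.map_map, hτ.1, hσ.1]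
  · rw [e, ← Subgroup.map_map, hτ.2.1, hσ.2.1]

/-- The inverse of a Goeritz realiser is one. [folklore] -/
theorem goeritz_symm {σ : SurfaceGroup 3 ≃* SurfaceGroup 3} {f : H₁ ≃ₗ[ℤ] H₁} (hσ : Goeritz⟪σ, f⟫) :
    Goeritz⟪σ.symm, f⁻¹⟫ := by
  have hid : σ.symm.toMonoidHom.comp σ.toMonoidHom = MonoidHom.id _ := by ext; simp
  have key : ∀ K : Subgroup (SurfaceGroup 3), K.map σ.toMonoidHom = K → K.map σ.symm.toMonoidHom = K :=
    fun K h => by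
      calc K.map σ.symm.toMonoidHom = (K.map σ.toMonoidHom).map σ.symm.toMonoidHom := by rw [h]
        _ = K := by rw [Subgroup.map_map, hid, Subgroup.map_id]
  exact ⟨key _ hσ.1, key _ hσ.2.1, realises_inv hσ.2.2⟩

/-- **The realisable subgroup.** The linear automorphisms of `H₁` induced by Goeritz elements form a
subgroup of `GL(H₁)` containing `moveX 0 c`, `moveW 0 1 c`, `moveW 0 2 c`, `moveW 1 2 c`, `moveE c`,
`moveZ 0 1 c`, `moveZ 0 2 c`, the handle signs `negHandle k` and `negB` (helpers I–II; the parameter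
`c` by `shear_mem`). [folklore] -/
theorem exists_goeritzRealisable : ∃ R : Subgroup (H₁ ≃ₗ[ℤ] H₁),
    (∀ f ∈ R, ∃ σ : SurfaceGroup 3 ≃* SurfaceGroup 3, Goeritz⟪σ, f⟫) ∧
    (∀ c, moveX 0 c ∈ R) ∧ (∀ c, moveW 0 1 c ∈ R) ∧ (∀ c, moveW 0 2 c ∈ R) ∧ (∀ c, moveW 1 2 c ∈ R) ∧
    (∀ c, moveE c ∈ R) ∧ (∀ c, moveZ 0 1 (by decide) c ∈ R) ∧ (∀ c, moveZ 0 2 (by decide) c ∈ R) ∧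
    (∀ k, negHandle k ∈ R) ∧ negB ∈ R := by
  let R : Subgroup (H₁ ≃ₗ[ℤ] H₁) :=
    { carrier := {f | ∃ σ : SurfaceGroup 3 ≃* SurfaceGroup 3, Goeritz⟪σ, f⟫}
      mul_mem' := fun {f g} hf hg => by
        obtain ⟨σ, hσ⟩ := hf
        obtain ⟨τ, hτ⟩ := hg
        exact ⟨τ.trans σ, goeritz_trans hσ hτ⟩
      one_mem' := ⟨MulEquiv.refl _, by simp, by simp, fun s => rfl⟩
      inv_mem' := fun {f} hf => by
        obtain ⟨σ, hσ⟩ := hf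
        exact ⟨σ.symm, goeritz_symm hσ⟩ }
  refine ⟨R, fun f hf => hf, ?_, ?_, ?_, ?_, ?_, ?_, ?_, fun k => ⟨_, eps_goeritz k⟩,
    ⟨_, iotaEquiv_goeritz⟩⟩
  · exact shear_mem _ _ R ⟨_, x0_goeritz⟩
  · exact shear_mem _ _ R ⟨_, w01_goeritz⟩
  · exact shear_mem _ _ R ⟨_, w02_goeritz⟩
  · exact shear_mem _ _ R ⟨_, w12_goeritz⟩
  · exact shear_mem _ _ R ⟨_, e12_goeritz⟩
  · exact shear_mem _ _ R ⟨_, z01_goeritz⟩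
  · exact shear_mem _ _ R ⟨_, z02_goeritz⟩

/-! ## The stub -/

/-- `negB` negates the intersection form. [folklore] -/
theorem symplForm_negB (u v : H₁) : symplForm (negB u) (negB v) = -symplForm u v := by
  rw [symplForm_three, symplForm_three]
  simp
  ring

/-- **Genus-3 Goeritz realisation, genus-`3` vocabulary.** Every `±`-isometry of `H₁` preserving the
spans of the two cut systems is induced by a Goeritz element. [folklore] -/
theorem goeritzRealisation_three (F : H₁ ≃ₗ[ℤ] H₁) (ε : ℤ) (hε : ε = 1 ∨ ε = -1)
    (hiso : ∀ u v : H₁, symplForm (F u) (F v) = ε * symplForm u v)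
    (h0 : (Submodule.span ℤ ((fun y => δ[y]) '' (s4Gens 0 : Set (surfaceGen 3)))).map F.toLinearMap =
      Submodule.span ℤ ((fun y => δ[y]) '' (s4Gens 0 : Set (surfaceGen 3))))
    (h1 : (Submodule.span ℤ ((fun y => δ[y]) '' (s4Gens 1 : Set (surfaceGen 3)))).map F.toLinearMap =
      Submodule.span ℤ ((fun y => δ[y]) '' (s4Gens 1 : Set (surfaceGen 3)))) :
    ∃ x : SurfaceGroup 3 ≃* SurfaceGroup 3, Goeritz⟪x, F⟫ := by
  obtain ⟨R, hreal, hX, hW01, hW02, hW12, hER, hZ01, hZ02, hN, hB⟩ := exists_goeritzRealisable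
  have hF0 : ∀ v : H₁, InL0⟪v⟫ → InL0⟪F v⟫ := fun v hv =>
    (mem_span_s4Gens_zero_iff _).1 (h0.le (Submodule.mem_map_of_mem ((mem_span_s4Gens_zero_iff v).2 hv)))
  have hF1 : ∀ v : H₁, InL1⟪v⟫ → InL1⟪F v⟫ := fun v hv =>
    (mem_span_s4Gens_one_iff _).1 (h1.le (Submodule.mem_map_of_mem ((mem_span_s4Gens_one_iff v).2 hv)))
  refine hreal F ?_
  rcases hε with rfl | rfl
  · exact mem_of_stabiliser moveE negHandle moveE_apply negHandle_apply R hX hW01 hW02 hW12 hER hZ01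
      hZ02 hN F ⟨fun u v => by rw [hiso, one_mul], hF0, hF1⟩
  · have hneg : InP⟪negB * F⟫ :=
      stabiliser_of_neg symplForm_negB
        (fun v hv => ⟨by simp [hv.1], by simp [hv.2.1], by simp [hv.2.2]⟩)
        (fun v hv => ⟨by simp [hv.1], by simp [hv.2.1], by simp [hv.2.2]⟩)
        (fun u v => by rw [hiso, neg_one_mul]) hF0 hF1
    exact mem_of_mul_mem hB (mem_of_stabiliser moveE negHandle moveE_apply negHandle_apply R hX hW01
      hW02 hW12 hER hZ01 hZ02 hN _ hneg)

/-- **Stub `stub_goeritzRealisationThree`** (GS₀ at genus `3`, `m = 0`): the Goeritz group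
`Stab N₀ ∩ Stab N₁` of the genus-3 splitting `(⟪a₀,a₁,b₂⟫, ⟪a₀,b₁,a₂⟫)` of `S¹×S²` realises every
`±`-isometry of `H₁ = ℤ⁶` stabilising `Λ₀ = ⟨a₀,a₁,b₂⟩`, `Λ₁ = ⟨a₀,b₁,a₂⟩` (proof in the module
docstring; `s4CutSystem 0 i = s4Gens i`, `s4Kernels.stabilizeIter 0 = s4Kernels`). [folklore] -/
theorem stub_goeritzRealisationThree :
    ∀ (F : (surfaceGen (3 + 3 * 0) → ℤ) ≃ₗ[ℤ] (surfaceGen (3 + 3 * 0) → ℤ)) (ε : ℤ), (ε = 1 ∨ ε = -1) →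
      (∀ u v : surfaceGen (3 + 3 * 0) → ℤ, symplForm (F u) (F v) = ε * symplForm u v) →
      (Submodule.span ℤ ((fun y => (Pi.single y (1 : ℤ) : surfaceGen (3 + 3 * 0) → ℤ)) ''
          s4CutSystem 0 0)).map F.toLinearMap =
        Submodule.span ℤ ((fun y => (Pi.single y (1 : ℤ) : surfaceGen (3 + 3 * 0) → ℤ)) ''
          s4CutSystem 0 0) →
      (Submodule.span ℤ ((fun y => (Pi.single y (1 : ℤ) : surfaceGen (3 + 3 * 0) → ℤ)) ''
          s4CutSystem 0 1)).map F.toLinearMap =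
        Submodule.span ℤ ((fun y => (Pi.single y (1 : ℤ) : surfaceGen (3 + 3 * 0) → ℤ)) ''
          s4CutSystem 0 1) →
      ∃ x : SurfaceGroup (3 + 3 * 0) ≃* SurfaceGroup (3 + 3 * 0),
        (s4Kernels.stabilizeIter 0 0).map x.toMonoidHom = s4Kernels.stabilizeIter 0 0 ∧
        (s4Kernels.stabilizeIter 0 1).map x.toMonoidHom = s4Kernels.stabilizeIter 0 1 ∧
        ∀ s : SurfaceGroup (3 + 3 * 0),
          toAdd (SurfaceGroup.abelianize (3 + 3 * 0) (x s)) =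
            F (toAdd (SurfaceGroup.abelianize (3 + 3 * 0) s)) := by
  intro F ε hε hiso h0 h1
  rw [s4CutSystem_zero] at h0 h1
  exact goeritzRealisation_three F ε hε hiso h0 h1

end Summit.SmoothPoincare4.SmoothPoincare4.Theorems.ShadowApproximation.NilpotentGenusClass

end
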